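import Summits.BirchSwinnertonDyer.BirchSwinnertonDyer.Theorems.ResidualThetaTransportAtTwoResidualThetaCountLowerPureAtTwoOfLambdaLower
import Summits.BirchSwinnertonDyer.BirchSwinnertonDyer.Theorems.ResidualThetaTransportAtTwoLambdaLowerBoundOWeierstrass
import Summits.BirchSwinnertonDyer.BirchSwinnertonDyer.Theorems.ResidualThetaTransportAtTwoLambdaLowerBoundOExact
import Summits.BirchSwinnertonDyer.BirchSwinnertonDyer.Theorems.ResidualThetaTransportAtTwoThetaTransportLatticeHomothety
import Summits.BirchSwinnertonDyer.BirchSwinnertonDyer.Theorems.ResidualThetaTransportAtTwoThetaTransportRankTwoPhiLines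
import Summits.BirchSwinnertonDyer.BirchSwinnertonDyer.Theorems.ResidualThetaTransportAtTwoThetaTransportFirstLemmas
import Summits.BirchSwinnertonDyer.BirchSwinnertonDyer.Theorems.ThetaPartnerAtTwoSerreSupersingularDecompositionImageInput
import Literature.NumberTheory.EllipticCurves.GreenbergSelmerNewform
import Literature.NumberTheory.EllipticCurves.NewformGaloisRep
import Literature.NumberTheory.EllipticCurves.PadicCoeffIntegersFrobeniusData
import Summits.BirchSwinnertonDyer.BirchSwinnertonDyer.Theorems.ResidualThetaTransportAtTwoResidualSignedLambdaLowerCMAtTwoStubKzgChildA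
import Literature.NumberTheory.EllipticCurves.Kato2004.IwasawaCohomologyCoeffExistsProofs
import HarnessLib
import Summits.BirchSwinnertonDyer.BirchSwinnertonDyer.Theorems.ResidualThetaTransportAtTwoResidualSignedLambdaLowerCMAtTwoClosedModPrint
import Summits.BirchSwinnertonDyer.BirchSwinnertonDyer.Theorems.ResidualThetaTransportAtTwoKatoZetaDefs
import Summits.BirchSwinnertonDyer.BirchSwinnertonDyer.Theorems.ResidualThetaTransportAtTwoThetaTransportResidualIso
import Summits.BirchSwinnertonDyer.BirchSwinnertonDyer.Theorems.ResidualThetaTransportAtTwoThetaTransportResidualCount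
import Summits.BirchSwinnertonDyer.BirchSwinnertonDyer.Theorems.ResidualThetaTransportAtTwoResidualSignedLambdaLowerCMAtTwoChildABOfQuotientFact
import Summits.BirchSwinnertonDyer.BirchSwinnertonDyer.Theorems.ResidualThetaTransportAtTwoResidualSignedLambdaLowerCMAtTwoClosedModPrintChildAB
import Literature.NumberTheory.EllipticCurves.Kato2004.ZetaElementNewformTatePairingValuesQuotientTwo

/-!
v10 (LEAD rtt-p2 g21, 2026-08-29): ROAD M — {`stub_kzgChildA`, `stub_kzgChildB`} REPLACED by ONE print node `stub_kzgChildAB` DISCHARGED BY NAME from the typed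
MERGED fact `Kato2004.exists_zetaElement_newform_tatePairing_values_quotient_two` (p736193; `OnePair.stub_kzgChildAB_of_quotientFact`);
`stub_kzgChildAB := OnePair.ChildAB.childAB_of_quotientFact … cite.2.2 …` (3 lines over the landed port p740817) and `stub_cmLambdaLower` (= RSL_g's text) is the K0b-free
composition `LambdaLowerBoundO.residualSignedLambdaLowerCMAtTwo_of_parts₂ K0a_holds (ChildAB.katoZetaBody_of_childAB (KZgGlue.iHalf_of_stations (E) (DESC) (R)) stub_kzgChildAB)
(OnePair.stub_onePairSupply cite.2.1 S1⊕ EH S4₂ S4₀ S2)` — every kernel station of onepair a tree theorem (citable form: `OnePair.ChildAB.residualSignedLambdaLowerCMAtTwo_of_quotientFact`,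
`…ChildABClosedOfQuotientFact`, p741505). OPEN `sorry`s: PUB-G 24143 · GZK 19921 · PUB-CM 27719 (route leaves BY NAME) + `stub_printInputsRSLg` (PURE CITE) —
nothing else. BSD is not proved by this; 26074 OPEN.
-/

/-!
# Skeleton of record «bt26-lambda» (θ-transport line) for the crux (R≥)ᵖ `ResidualThetaCountLowerPureAtTwo`
# (stmt-BirchSwinnertonDyer-26074) — lead rtt-p2 g11, per director-bsd g13 (180) 11:03:46Z and TRIAGE-r1-1 and TRIAGE-r1-2

BSD is not proved by this. Card: `Lines/bt26-lambda.md`; design memos `LINE-DESIGN-g11.md` v2 (= THETA-LINE-ideator2-r1g5).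

THE LINE. The crux's conclusion `2^(d+Σ_g) ≤ #R⁺_{S₀}(W[2]/ℚ_∞)` carries no W-side λ; it IS the residual
plus-main-conjecture λ-LOWER bound for the CM form `g` at `2` read in W's clothes. The g-side objects are
INLINED (no new definition): an integral model `ρ : Γ_ℚ → GL₂(𝒪)` of `ρ_{g,ι}` (`𝒪 = padicCoeffIntegers (range ι)`),
its cofree module `A_g = Cofree ρ E` (tree), and a LOCAL TRANSPORT DATUM at `2`: a `D₂`-equivariant additive
isomorphism `Θ_v : A_g ≃ W[2^∞]ⁿ` (local universality `T_g|_{G_ℚ₂} ≅ T₂W ⊗ 𝒪`; `n = [𝒪:ℤ₂]` is forced). The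
g-side `S₀`-imprimitive plus-Selmer set `Sel⁺_{S₀}(ℚ_∞, A_g)[ϖ]` is the set-builder written in the stubs:
unramified outside `S₀ ∪ {2, ∞}`, archimedean-trivial, and AT `2` the Θ-coordinatewise Kummer condition cut out
by `⨆ₙ E⁺(k_n)` (verbatim the tree's `Kobayashi2003.localKummerOverOfEmb` with `Θ` inserted), cut to `ϖ`-torsion
by `scalarH1 ϖ`. By Schur (`End_{D₂}(T₂W) = ℤ₂`, W[2]|_{I₂} irreducible) the transported condition does not
depend on `Θ` (any two differ by `GL_n(ℤ₂)`, which preserves `(E⁺)ⁿ`).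

STUBS (v9 by lead rtt-p2 g20 16:5xZ: child A `stub_kzgChildA` PORTED by name (`OnePair.stub_kzgChildA_of_zetaElement`, w3 g19 p728621) from the Kato 12.5 (1) fact, which joins the cite stub; K0a leaves it (theorem `…_holds`); open = PUB-G · GZK · PUB-CM · cite · child B. v8 2026-08-29T15:1xZ: `stub_cmLambdaLower` (= RSL_g 22608's text) is CLOSED MODULO PRINT — it is now `:= Theorems.OnePair.residualSignedLambdaLowerCMAtTwo_closed_mod_print stub_printInputsRSLg stub_kzgChildA stub_kzgChildB` (certificate p727151 over line onepair v3h, whose kernel stubs are all tree theorems), with THREE new registered PRINT stubs carrying the residue per director (390) VARIANT-N: `stub_printInputsRSLg` [CITE-ONLY: K0a, K0b, LVsq], `stub_kzgChildA` / `stub_kzgChildB` (PRINT-AT-PINS KZ_g children, texts = onepair's verbatim); `stub_residualIso` / `stub_transport` are no longer declared here — the skeleton imports their LANDED namesakes (`Theorems/…ThetaTransportResidualIso` p634266, `…ThetaTransportResidualCount` p641162, same FQN) and `_of` uses them by name; open stubs of this line are now ALL print: PUB-G, GZK, PUB-CM (route-leaf items by name) + these three. v7: 6; v7 by lead rtt-p2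 g18 2026-08-29T06:5xZ: `stub_cmLambdaLower` carries RSL_g's item text VERBATIM again (a68f287a3404f83e) at the pen's request (cone matcher reads texts, not names); v6 by lead rtt-p2 g13 2026-08-28T18Z: S2 `stub_cmLambdaLower` is now BY NAME = the route's NEW crux item
`ResidualSignedLambdaLowerCMAtTwo` (RSL_g, stmt-BirchSwinnertonDyer-22608, text = the v5 stub verbatim; pen bsd-wall-p2 g17 «GO S2 crux» EXECUTED
16:11Z, RTT rev 36); the Serre print input is no longer a stub — item 27793 is CLOSED·proved and `_of` calls the landed theorem
`InputsSweep.residualThetaTransportAtTwo_serreSupersingularDecompositionImageInput_proof` (tp2-w8). v5: `stub_cmLambdaLower` restated in `Set.encard` form behind a term-level `open … in`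
(equivalent; 10 542 → < 3900 characters, the registry cap); v4: `stub_thetaDatum` is now BY NAME = the route's HOLD print binder
`PublishedInputsCMSideAtTwo` (item stmt-BirchSwinnertonDyer-27719, text = the v3 `stub_thetaDatum` verbatim), as the pen ruled 11:58:25Z;
v3 by lead g12 — (b) split off as `stub_residualIso`, LANDED p634266; `stub_serreSupersingularDecompositionImageInput` (Serre 1972
Prop. 12, route item 27793 = 4th conjunct of PUB⁵ 27435, by name) added as the one print input of `stub_transport`, which is LANDED
modulo it): `stub_publishedInputsGreenbergControlAtTwo` (PUB-G 24143, by name) · `stub_rankEqAnalyticRankLeOne`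
(GZK 19921, by name) — both only for FINITENESS of the W-side set (p619334) · `stub_thetaDatum` (FACT-grade ∃:
Deligne–Carayol integral model + local universality at 2 [Fontaine/Saito1997/Tate, or Honda type `T²+2`] — the
integral half is KERNEL: `ThetaTransport.latticeHomothety` p626359, `…RankTwoPhiLines` p626723) · `stub_residualIso` ((b): `((W[2^∞])[2])^f ≅ A_g[ϖ]`, Chebotarev + Brauer–Nesbitt —
PROVED, `Theorems/…ThetaTransportResidualIso`) · `stub_transport`
((d)+(e): residual control, local conditions along `j`, count
`#Sel_g[ϖ] = (#R_W)^f`, `q = 2^f`; θ2 `residualBaseChangeCard` p626026 is its counting half) · **`stub_cmLambdaLower`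
= S2, THE HARDEST STUB (research): `q^(d+Σ_g) ≤ #Sel_g[ϖ]` — BT26 Thm 2.6 (Kato MC ⊗ℚ for g at 2, FACT, to be typed)
+ the PORT of Kobayashi §6–§8 / Coleman ± / four-term sequence for the local type `T²+2` ⊗𝒪 + the kernel algebra
p624860 (`q^λ ≤ #(X/ϖX)`, μ=0 for free), p625410 (`λ(Λ_𝒪/(Lm)) = d`), p625690 (four-term λ), p627158 (GV local terms).**
`ResidualThetaCountLowerPureAtTwo_of` composes them to the crux BY NAME (`(2^(d+Σ))^f ≤ (#R_W)^f ⇒ 2^(d+Σ) ≤ #R_W`).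
Width tasks (gl1-plus card P1–P4, SketchC1g5.lean) shorten the local part of S2/stub_transport; not stubs.
-/

set_option autoImplicit false
set_option linter.dupNamespace false
set_option maxHeartbeats 800000

noncomputable section

open scoped Classical

namespace Summit.BirchSwinnertonDyer.BirchSwinnertonDyer.Cruxes.ResidualThetaCountLowerPureAtTwo.Bt26Lambda

/-- Stub (by name): the route's print binder PUB-G, item stmt-BirchSwinnertonDyer-24143. -/
theorem stub_publishedInputsGreenbergControlAtTwo :
    Summit.BirchSwinnertonDyer.BirchSwinnertonDyer.Theses.ResidualThetaTransportAtTwo.PublishedInputsGreenbergControlAtTwo := by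
  sorry

/-- Stub (by name): the route's print binder GZK, item stmt-BirchSwinnertonDyer-19921. -/
theorem stub_rankEqAnalyticRankLeOne :
    Summit.BirchSwinnertonDyer.BirchSwinnertonDyer.Theses.ResidualThetaTransportAtTwo.RankEqAnalyticRankLeOne := by
  sorry

/-- Stub `stub_thetaDatum` (v4: BY NAME). The g-side datum — an integral model `ρ : Γ_ℚ → GL₂(𝒪)` of `ρ_{g,ι}`
(unramified with Frobenius polynomial `X² − ι(a_ℓ(g))X + ℓ` at every `ℓ ∤ 2M`: Deligne–Carayol) and, at the place over `2`,
a `D₂`-equivariant additive isomorphism `Θ : A_g = Cofree ρ E ≃ W[2^∞]ⁿ` (local universality `T_g|_{G_ℚ₂} ≅ T₂W ⊗ 𝒪`: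
Fontaine + Saito 1997 + Tate; integral step = `ThetaTransport.latticeHomothety` p626359) — is the route's HOLD print binder
PUB-CM `PublishedInputsCMSideAtTwo` (item stmt-BirchSwinnertonDyer-27719; its text is the v3 `stub_thetaDatum` statement
verbatim, pen bsd-wall-p2 g16 11:58:25Z «reshape `stub_thetaDatum := by name`»). Never a prover target; closes by citation
once (P1)(P2) are typed under `Literature/`. -/
theorem stub_thetaDatum :
    Summit.BirchSwinnertonDyer.BirchSwinnertonDyer.Theses.ResidualThetaTransportAtTwo.PublishedInputsCMSideAtTwo := by
  sorry

/-- **`stub_printInputsRSLg` [CITE-ONLY — never a proof target, never benched, never counted]** (director-bsd (390) VARIANT-N shape): the PURE print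
facts behind `stub_cmLambdaLower` (= RSL_g 22608; same text as line onepair's `stub_printInputs` v3j), Literature declarations BY NAME and nothing else — K0b `Kato2004.thm12_4_newform` (Kato Thm. 12.4 (1)(2); DISPLAY-ONLY, a
conjunct of the S3″ text of item 24105, not consumed below) ∧ LVsq `ModularForms.cmNewform_gamma0_sq_dvd_level` (Ribet 1977) ∧ the MERGED Kato–Burungale–Tian
fact `Kato2004.exists_zetaElement_newform_tatePairing_values_quotient_two` (p736193, LEAD rtt-p2 g21: Kato Thm. 12.5 (1)(2) + 12.4 (1) + Burungale–Tian
Thm. 2.6 for the CM form at `p = 2` — p726418's telescope + CM hypothesis + fine-Selmer pin + (FIN)/(FINX)/(LAM) about THE SAME class), from which the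
print node child AB is PORTED in kernel (`OnePair.stub_kzgChildAB_of_quotientFact`). K0a is the THEOREM `…_holds`.
[cite: Kato2004Asterisque, Thm. 12.4 (p. 221), Thm. 12.5 (1)(2) (pp. 221–222), §15.16 (p. 265)] [cite: BurungaleTian2026, Thm. 2.6 (p. 5)]
[cite: Ribet1977Nebentypus, §4 Thm. (4.5) with §3 Cor. (3.5)] -/
theorem stub_printInputsRSLg :
    Literature.NumberTheory.EllipticCurves.Kato2004.thm12_4_newform ∧ Literature.NumberTheory.EllipticCurves.ModularForms.cmNewform_gamma0_sq_dvd_level ∧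
    Literature.NumberTheory.EllipticCurves.Kato2004.exists_zetaElement_newform_tatePairing_values_quotient_two := by
  sorry

/-- **KZ_g child AB `stub_kzgChildAB` — the MERGED print node (ROAD M, critic STUB-PLAN rev 33.1 S165/S170 (b); director-bsd (390) VARIANT-N), NOT A `sorry`:
PORTED IN KERNEL from the typed fact `Kato2004.exists_zetaElement_newform_tatePairing_values_quotient_two`** (LEAD rtt-p2 g21, p736193) by
`Theorems.OnePair.ChildAB.childAB_of_quotientFact` (LEAD rtt-p2 g21, p740817 `…ChildABOfQuotientFact`: value part = w3 g19's p728621 body on the destructured telescope; fine-Selmer pin `ChildAB.exists_finePin` over H-STAB of w3 g20's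
`…ChildBKitSelmer` p735735; μt := 1; w3 g20's twin port p738520 `OnePair.stub_kzgChildAB_of_quotientFact` is interchangeable). Text = child B's registered telescope VERBATIM with
`∀ (z c′ w q μt), KVC → (ii_fin) ∧ (ii_λ)` turned into `∃ (z c′ w q μt), KVC ∧ (ii_fin) ∧ (ii_λ)` (one valued class WITH its λ-side: Kato 12.5 (1)(2),
Burungale–Tian 2.6 speak of THE class `z_γ` — critic T92). It replaces the pair {`stub_kzgChildA` (∃), `stub_kzgChildB` (∀ →)} of v3i / v9.
[cite: Kato2004Asterisque, Thm. 12.4 (1)(2), Thm. 12.5 (1)(2) (pp. 221–222), §15.16 (p. 265)] [cite: BurungaleTian2026, Thm. 2.6 (p. 5)] -/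
theorem stub_kzgChildAB :
    open Literature.NumberTheory.EllipticCurves GreenbergSelmer GreenbergVatsal2000 Kobayashi2003 ModularForms Rank1Residual Literature.NumberTheory.GaloisRepresentations Literature.NumberTheory.Automorphic IsDedekindDomain NumberField Field Rat.HeightOneSpectrum PowerSeries Summit.BirchSwinnertonDyer.BirchSwinnertonDyer.Theorems.OnePair in ∀ (W : WeierstrassCurve ℚ) [W.IsElliptic] [W.IsGloballyMinimal], ¬ W.HasCM → W.analyticRank = 0 → GoodSS W 2 → W.frobeniusTrace 2 = 0 → W.Δ < 0 → ∀ (M : ℕ) [NeZero M] (g : CuspForm (CongruenceSubgroup.Gamma0 M) 2) (ι : coeffField g →+* PadicAlgCl 2) (Ω : ℂ), Odd M → IsNewform0 g → IsCMForm (liftToGamma1 M 2 g) → cuspCoeff g 2 = 0 → IsCohomologicalPlusPeriod g ι Ω → (∀ ℓ : ℕ, ℓ.Prime → ¬ ℓ ∣ 2 * M * W.conductorNorm ℤ → ‖embCoeff g ι ℓ - (W.frobeniusTrace ℓ : PadicAlgCl 2)‖ < 1) → ∀ (κ : ZpExtension ℚ 2) (γ : absoluteGaloisGroup ℚ), κ.IsCyclotomic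 → κ.IsTopGenerator γ → IsCyclotomicVariable 2 γ → ∀ (S₀ : Finset (HeightOneSpectrum (RingOfIntegers ℚ))), (∀ v ∈ S₀, ((2 : ℕ) : RingOfIntegers ℚ) ∉ v.asIdeal) → (∀ v, ¬ W.HasGoodReductionAt v → v ∈ S₀) → (∀ v, natGenerator v ∣ M → v ∈ S₀) → ∀ (Lp Lm : IwasawaAlgebraO (Set.range ι)) (d : ℕ), IsPollackPairK g ι Ω Lp Lm → (∀ k, ‖coeff k (iwasawaOToPowerSeries (Set.range ι) Lm)‖ ≤ ‖coeff d (iwasawaOToPowerSeries (Set.range ι) Lm)‖) → (∀ k < d, ‖coeff k (iwasawaOToPowerSeries (Set.range ι) Lm)‖ < ‖coeff d (iwasawaOToPowerSeries (Set.range ι) Lm)‖) → ∀ (n : ℕ) (ρ : FramedGaloisRep ℚ (coeffO (Set.range ι)) 2) (Θ : ∀ v : HeightOneSpectrum (RingOfIntegers ℚ), ((2 : ℕ) : RingOfIntegers ℚ) ∈ v.asIdeal → (CofreeF (Set.range ι) ρ ≃+ (Fin n → ↥(W.geomPrimaryTorsion 2)))), (∀ v, ¬ natGenerator v ∣ 2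 * M → ρ.IsUnramifiedAt v ∧ ∃ P : Polynomial (coeffO (Set.range ι)), P.map (padicCoeffIntegers (Set.range ι)).subtype = Polynomial.X ^ 2 - Polynomial.C (embCoeff g ι (natGenerator v)) * Polynomial.X + Polynomial.C ((natGenerator v : ℕ) : PadicAlgCl 2) ∧ ρ.HasFrobCharpolyAt v P) → ∀ (hΘ : ∀ v hv (δ : absoluteGaloisGroup (v.adicCompletion ℚ)) m i, Θ v hv (resGalOfEmb (closureEmb (K := ℚ) (v.adicCompletion ℚ)) δ • m) i = resGalOfEmb (closureEmb (K := ℚ) (v.adicCompletion ℚ)) δ • Θ v hv m i), ∀ (ϖ : (coeffO (Set.range ι))), Irreducible ϖ → ∀ (Sg : AddSubgroup (H1Γ (Set.range ι) κ ρ)) [Module (coeffO (Set.range ι)) ↥Sg], (∀ (a : (coeffO (Set.range ι))) (s : ↥Sg), ((a • s : ↥Sg) : H1Γ (Set.range ι) κ ρ) = scalarH1 κ.kerSubgroup (CofreeF (Set.range ι) ρ) a s) → (∀ y : H1Γ (Set.range ι) κ ρ, y ∈ Sg ↔ y ∈ plusSelmerSet (Set.range ι) W κ S₀ n ρ Θ)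 → (∀ (τ : absoluteGaloisGroup ℚ) (y : H1Γ (Set.range ι) κ ρ), y ∈ Sg → conjH1 κ.kerSubgroup (CofreeF (Set.range ι) ρ) τ y ∈ Sg) → (plusSelmerTorsionSet (Set.range ι) W κ S₀ n ρ Θ ϖ).Finite → ∀ (I : Kato2004.IwasawaH1DataCoeff (FramedGaloisRep.toGaloisRep ρ) 2 κ γ) [Module (coeffO (Set.range ι)) I.H] [IsScalarTower (coeffO (Set.range ι)) (IwasawaAlgebraO (Set.range ι)) I.H], (∀ (a : (coeffO (Set.range ι))) (x : I.H), a • x = (PowerSeries.C a : IwasawaAlgebraO (Set.range ι)) • x) → ∀ (π : OnePairPins (Set.range ι) W κ γ S₀ n ρ Θ hΘ I Sg), ∀ (F : π.KatoFrame), ∃ (z : I.H) (c' : Fin n → coeffO (Set.range ι)) (w : ℕ → Fin π.nb → PadicAlgCl 2) (q : PadicAlgCl 2) (μt : IwasawaAlgebraO (Set.range ι)), π.KatoValuedClass g ι Ω F.Φ F.τ z c' w q μt ∧ Module.Finite (FractionRing (coeffO (Set.range ι))) (TensorProduct (coeffO (Set.range ι)) (FractionRing (coeffO (Set.range ι)))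 (zetaQuot I z)) ∧ lamO (Set.range ι) (zetaQuot I z) ≤ lamO (Set.range ι) (CharacterModule ↥π.Sel₀) + lamO (Set.range ι) (IwasawaAlgebraO (Set.range ι) ⧸ Ideal.span {μt}) := by
  intro W _ _ hcm hr hss ha hΔ M _ g ι Ω hM hg hcmg ha2 hΩ hcong κ γ hκ hγ hcv S₀ hS₀2 hS₀bad hS₀M Lp Lm d hPP hlam1 hlam2 n ρ Θ hfrob hΘ ϖ hϖ
    Sg _ hSg1 hSg2 hSg3 hfin I _ _ hIC π F
  exact Summit.BirchSwinnertonDyer.BirchSwinnertonDyer.Theorems.OnePair.ChildAB.childAB_of_quotientFact g ι Ω π F stub_printInputsRSLg.2.2 hg hΩ.isPlusPeriod hcmg hM ha2 hfrob hκ hγ hS₀2 hSg2 hSg1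

/-- **`stub_cmLambdaLower` = RSL_g (crux stmt-BirchSwinnertonDyer-22608) — v10: CLOSED MODULO TWO CITED LITERATURE FACTS (LVsq, the Kato–Burungale–Tian quotient fact)** composed INLINE from the landed stations, the GLUE and the merged child-AB port `ChildAB.childAB_of_quotientFact` (`…ChildABOfQuotientFact`, p740817) through `ChildAB.katoZetaBody_of_childAB` (p736564); formerly (v8/v9) by the landed certificate
`Theorems.OnePair.residualSignedLambdaLowerCMAtTwo_closed_mod_print` (p727151; line onepair v3h on 22608: every kernel stub a tree theorem — S2, S1⊕, S4₂,
S4₀ p718059, EH p714878, GLUE p723772, (E) p722652, (DESC) p718630, (R) p725106, KZ_g glue p719630) fed with the three print stubs above. The text below is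
RSL_g's item text VERBATIM (unchanged since v5; `Iff.rfl` with the route decl). [cite: Kato2004Asterisque, Thm. 12.5 (1)(2) (p. 222)] [cite: Kobayashi2003, Thm. 7.3] -/
theorem stub_cmLambdaLower : open Literature.NumberTheory.EllipticCurves GreenbergSelmer GreenbergVatsal2000 Kobayashi2003 ModularForms Rank1Residual Literature.NumberTheory.GaloisRepresentations Literature.NumberTheory.Automorphic IsDedekindDomain NumberField Field Rat.HeightOneSpectrum PowerSeries in ∀ (W : WeierstrassCurve ℚ) [W.IsElliptic] [W.IsGloballyMinimal], ¬ W.HasCM → W.analyticRank = 0 → GoodSS W 2 → W.frobeniusTrace 2 = 0 → W.Δ < 0 → ∀ (M : ℕ) [NeZero M] (g : CuspForm (CongruenceSubgroup.Gamma0 M) 2) (ι : coeffField g →+* PadicAlgCl 2) (Ω : ℂ), Odd M → IsNewform0 g → IsCMForm (liftToGamma1 M 2 g) → cuspCoeff g 2 = 0 → IsCohomologicalPlusPeriod g ι Ω → (∀ ℓ : ℕ, ℓ.Prime → ¬ ℓ ∣ 2 * M * W.conductorNorm ℤ → ‖embCoeff g ι ℓ - (W.frobeniusTrace ℓ : PadicAlgCl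 2)‖ < 1) → ∀ (κ : ZpExtension ℚ 2) (γ : absoluteGaloisGroup ℚ), κ.IsCyclotomic → κ.IsTopGenerator γ → IsCyclotomicVariable 2 γ → ∀ (S₀ : Finset (HeightOneSpectrum (RingOfIntegers ℚ))), (∀ v ∈ S₀, ((2 : ℕ) : RingOfIntegers ℚ) ∉ v.asIdeal) → (∀ v, ¬ W.HasGoodReductionAt v → v ∈ S₀) → (∀ v, natGenerator v ∣ M → v ∈ S₀) → ∀ (Lp Lm : IwasawaAlgebraO (Set.range ι)) (d : ℕ), IsPollackPairK g ι Ω Lp Lm → (∀ k, ‖coeff k (iwasawaOToPowerSeries (Set.range ι) Lm)‖ ≤ ‖coeff d (iwasawaOToPowerSeries (Set.range ι) Lm)‖) → (∀ k < d, ‖coeff k (iwasawaOToPowerSeries (Set.range ι) Lm)‖ < ‖coeff d (iwasawaOToPowerSeries (Set.range ι) Lm)‖) → ∀ (n : ℕ) (ρ : FramedGaloisRep ℚ ↥(padicCoeffIntegers (Set.range ι)) 2) (Θ : ∀ v : HeightOneSpectrum (RingOfIntegers ℚ), ((2 : ℕ) : RingOfIntegers ℚ) ∈ v.asIdeal → (Cofree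 ρ ↥(padicCoeffField (Set.range ι)) ≃+ (Fin n → ↥(W.geomPrimaryTorsion 2)))), (∀ v, ¬ natGenerator v ∣ 2 * M → ρ.IsUnramifiedAt v ∧ ∃ P : Polynomial ↥(padicCoeffIntegers (Set.range ι)), P.map (padicCoeffIntegers (Set.range ι)).subtype = Polynomial.X ^ 2 - Polynomial.C (embCoeff g ι (natGenerator v)) * Polynomial.X + Polynomial.C ((natGenerator v : ℕ) : PadicAlgCl 2) ∧ ρ.HasFrobCharpolyAt v P) → (∀ v hv (δ : absoluteGaloisGroup (v.adicCompletion ℚ)) m i, Θ v hv (resGalOfEmb (closureEmb (K := ℚ) (v.adicCompletion ℚ)) δ • m) i = resGalOfEmb (closureEmb (K := ℚ) (v.adicCompletion ℚ)) δ • Θ v hv m i) → ∀ (ϖ : ↥(padicCoeffIntegers (Set.range ι))), Irreducible ϖ → ((Nat.card (↥(padicCoeffIntegers (Set.range ι)) ⧸ Ideal.span {ϖ}) ^ (d + ∑ v ∈ S₀, 2 ^ padicValNat 2 ((natGenerator v ^ 2 - 1) / 8) * (if natGenerator v ∣ M then (if ‖embCoeff g ι (natGenerator v) - 1‖ < 1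 then 1 else 0) else (if ‖embCoeff g ι (natGenerator v)‖ < 1 then 2 else 0))) : ℕ) : ℕ∞) ≤ {y : subgroupH1 κ.kerSubgroup (Cofree ρ ↥(padicCoeffField (Set.range ι))) | y ∈ unramifiedOutside κ.kerSubgroup (Cofree ρ ↥(padicCoeffField (Set.range ι))) 2 ↑S₀ ∧ (∀ w σ, conjH1 κ.kerSubgroup (Cofree ρ ↥(padicCoeffField (Set.range ι))) σ y ∈ infKer κ.kerSubgroup (Cofree ρ ↥(padicCoeffField (Set.range ι))) w) ∧ (∀ v hv σ, ∃ (φ : _) (Q : Fin n → localPoints W (v.adicCompletion ℚ)) (k : ℕ), oneCocycleClass (discreteTopRep ↥κ.kerSubgroup (Cofree ρ ↥(padicCoeffField (Set.range ι)))) φ = conjH1 κ.kerSubgroup (Cofree ρ ↥(padicCoeffField (Set.range ι))) σ y ∧ (∀ i, (2 ^ k) • Q i ∈ ⨆ m : ℕ, signedLocalPoints κ (v.adicCompletion ℚ) W 1 m) ∧ ∀ τ i, pointsMapOfEmb W (closureEmb (K := ℚ) (v.adicCompletion ℚ)) (((Θ v hv (φ.1 (resGalSubgroupOfEmb κ.kerSubgroup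 (closureEmb (K := ℚ) (v.adicCompletion ℚ)) τ))) i : ↥(W.geomPrimaryTorsion 2)) : W.geomPoints) = (τ : absoluteGaloisGroup (v.adicCompletion ℚ)) • Q i - Q i) ∧ scalarH1 κ.kerSubgroup (Cofree ρ ↥(padicCoeffField (Set.range ι))) ϖ y = 0}.encard :=
  Summit.BirchSwinnertonDyer.BirchSwinnertonDyer.Theorems.LambdaLowerBoundO.residualSignedLambdaLowerCMAtTwo_of_parts₂
    Literature.NumberTheory.EllipticCurves.Kato2004.nonempty_iwasawaH1DataCoeff_newform_holds
    (Summit.BirchSwinnertonDyer.BirchSwinnertonDyer.Theorems.OnePair.ChildAB.katoZetaBody_of_childAB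
      (Summit.BirchSwinnertonDyer.BirchSwinnertonDyer.Theorems.OnePair.KZgGlue.iHalf_of_stations
        Summit.BirchSwinnertonDyer.BirchSwinnertonDyer.Theorems.OnePair.stub_kzgTrivialisation
        Summit.BirchSwinnertonDyer.BirchSwinnertonDyer.Theorems.OnePair.kzg_descent_closed
        Summit.BirchSwinnertonDyer.BirchSwinnertonDyer.Theorems.OnePair.stub_kzgValueRelation)
      stub_kzgChildAB)
    (Summit.BirchSwinnertonDyer.BirchSwinnertonDyer.Theorems.OnePair.stub_onePairSupply stub_printInputsRSLg.2.1
      Summit.BirchSwinnertonDyer.BirchSwinnertonDyer.Theorems.OnePair.stub_localDualAwayTwo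
      Summit.BirchSwinnertonDyer.BirchSwinnertonDyer.Theorems.OnePair.stub_reciprocity
      Summit.BirchSwinnertonDyer.BirchSwinnertonDyer.Theorems.OnePair.stub_deepHalfAtTwoStrict
      Summit.BirchSwinnertonDyer.BirchSwinnertonDyer.Theorems.OnePair.stub_deepHalfAwayTwo
      Summit.BirchSwinnertonDyer.BirchSwinnertonDyer.Theorems.OnePair.stub_plusColemanO)

/-- The crux BY NAME from the six stubs (v6): W-side finiteness (p619334 mod PUB-G ∧ GZK), the datum (PUB-CM, by name), the residual
isomorphism `j`, Serre's local image (THEOREM, tp2-w8), the transport count `#Sel_g[ϖ] = (#R_W)^f` with `#(𝒪/ϖ) = 2^f`, and the CM bound `2^(f(d+Σ_g)) ≤ #Sel_g[ϖ]`; then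
`(2^(d+Σ_g))^f ≤ (#R_W)^f ⇒ 2^(d+Σ_g) ≤ #R_W`. -/
theorem ResidualThetaCountLowerPureAtTwo_of :
    Summit.BirchSwinnertonDyer.BirchSwinnertonDyer.Theses.ResidualThetaTransportAtTwo.ResidualThetaCountLowerPureAtTwo := by
  intro W _ _ hCM hr0 hss ha2 hΔ M _ g ι Ω hM hnew hcmf ha2g hΩ hcong κ γ hκ hγ hcyc S₀ hS₀ hbad hMS D _ htors hμ
    Lp Lm d hpair hle hlt
  -- W-side finiteness of the counted set (PUB-G ∧ GZK, p619334)
  have hfinW := Summit.BirchSwinnertonDyer.BirchSwinnertonDyer.Theorems.ResidualLayer.residualPlus_finite_of_pub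
    stub_publishedInputsGreenbergControlAtTwo stub_rankEqAnalyticRankLeOne W hr0 hss ha2 hΔ κ γ hκ hγ S₀ hS₀ hbad D
    htors hμ
  -- the g-side datum
  obtain ⟨n, ρ, Θ, hρ, hΘ⟩ := stub_thetaDatum W hCM hr0 hss ha2 hΔ M g ι Ω hM hnew hcmf ha2g hΩ hcong
  -- a uniformiser of `𝒪 = padicCoeffIntegers (range ι)` (a DVR: the unit ball of `ℚ₂(ι K_g)`, finite over `ℚ₂`)
  haveI : FiniteDimensional ℚ (Literature.NumberTheory.EllipticCurves.ModularForms.coeffField g) :=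
    Literature.NumberTheory.EllipticCurves.ModularForms.IsNewform0.finiteDimensional_coeffField_holds hnew
  haveI : FiniteDimensional ℚ_[2] ↥(Literature.NumberTheory.EllipticCurves.padicCoeffField (Set.range ι)) :=
    Literature.NumberTheory.EllipticCurves.GreenbergSelmer.finiteDimensional_padicCoeffField ι
  have hdvr : IsDiscreteValuationRing ↥(Literature.NumberTheory.EllipticCurves.padicCoeffIntegers (Set.range ι)) := by
    rw [Literature.NumberTheory.EllipticCurves.padicCoeffIntegers_eq_unitBall]
    exact Summit.BirchSwinnertonDyer.BirchSwinnertonDyer.Theorems.LambdaLowerBoundO.isDiscreteValuationRing_unitBall 2 _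
  obtain ⟨ϖ, hϖ⟩ := IsDiscreteValuationRing.exists_irreducible ↥(Literature.NumberTheory.EllipticCurves.padicCoeffIntegers (Set.range ι))
  -- transport count and CM bound
  obtain ⟨f, hf0, hq, j, hjinj, hjsmul, hjrange⟩ := stub_residualIso W hss hΔ M g ι hnew hcong ρ hρ ϖ hϖ
  have hcount := stub_transport
    Summit.BirchSwinnertonDyer.BirchSwinnertonDyer.Theorems.InputsSweep.residualThetaTransportAtTwo_serreSupersingularDecompositionImageInput_proof
    W hss ha2 hΔ M g ι κ S₀ hMS n ρ Θ
    (fun v hv ↦ (hρ v hv).1) hΘ ϖ hϖ f j hjinj hjsmul hjrange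
  have hposW : 0 < {x : Literature.NumberTheory.EllipticCurves.subgroupH1 κ.kerSubgroup ↥(AddSubgroup.torsionBy ↥(W.geomPrimaryTorsion 2) (2 : ℤ)) | x ∈ Literature.NumberTheory.EllipticCurves.GreenbergVatsal2000.unramifiedOutside κ.kerSubgroup ↥(AddSubgroup.torsionBy ↥(W.geomPrimaryTorsion 2) (2 : ℤ)) 2 (↑S₀ : Set (IsDedekindDomain.HeightOneSpectrum (NumberField.RingOfIntegers ℚ))) ∧ (∀ (w : NumberField.InfinitePlace ℚ) (σ : Field.absoluteGaloisGroup ℚ), Literature.NumberTheory.EllipticCurves.conjH1 κ.kerSubgroup ↥(AddSubgroup.torsionBy ↥(W.geomPrimaryTorsion 2) (2 : ℤ)) σ x ∈ Literature.NumberTheory.EllipticCurves.GreenbergSelmer.infKer κ.kerSubgroup ↥(AddSubgroup.torsionBy ↥(W.geomPrimaryTorsion 2) (2 : ℤ)) w) ∧ (∀ (v : IsDedekindDomain.HeightOneSpectrum (NumberField.RingOfIntegers ℚ)), ((2 : ℕ) : NumberField.RingOfIntegers ℚ) ∈ v.asIdeal → ∀ σ : Field.absoluteGaloisGroup ℚ,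 W.conjH1 2 κ.kerSubgroup σ (Literature.NumberTheory.EllipticCurves.GreenbergVatsal2000.pushH1 κ.kerSubgroup (AddSubgroup.torsionBy ↥(W.geomPrimaryTorsion 2) (2 : ℤ)).subtype (fun _ _ ↦ rfl) x) ∈ Literature.NumberTheory.EllipticCurves.Kobayashi2003.localKummerOverOfEmb W 2 κ.kerSubgroup (Literature.NumberTheory.EllipticCurves.closureEmb (K := ℚ) (v.adicCompletion ℚ)) (⨆ n : ℕ, Literature.NumberTheory.EllipticCurves.Kobayashi2003.signedLocalPoints κ (v.adicCompletion ℚ) W 1 n))}.ncard := (Set.ncard_pos hfinW).2 ⟨0, by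
    refine ⟨AddSubgroup.zero_mem _, fun w σ => ?_, fun v hv σ => ?_⟩
    · rw [map_zero]; exact AddSubgroup.zero_mem _
    · rw [map_zero, map_zero]; exact AddSubgroup.zero_mem _⟩
  have hfinG : {y : Literature.NumberTheory.EllipticCurves.subgroupH1 κ.kerSubgroup (Literature.NumberTheory.EllipticCurves.GreenbergSelmer.Cofree ρ ↥(Literature.NumberTheory.EllipticCurves.padicCoeffField (Set.range ι))) | y ∈ Literature.NumberTheory.EllipticCurves.GreenbergVatsal2000.unramifiedOutside κ.kerSubgroup (Literature.NumberTheory.EllipticCurves.GreenbergSelmer.Cofree ρ ↥(Literature.NumberTheory.EllipticCurves.padicCoeffField (Set.range ι))) 2 (↑S₀ : Set (IsDedekindDomain.HeightOneSpectrum (NumberField.RingOfIntegers ℚ))) ∧ (∀ (w : NumberField.InfinitePlace ℚ) (σ : Field.absoluteGaloisGroup ℚ), Literature.NumberTheory.EllipticCurves.conjH1 κ.kerSubgroup (Literature.NumberTheory.EllipticCurves.GreenbergSelmer.Cofree ρ ↥(Literature.NumberTheory.EllipticCurves.padicCoeffField (Set.range ι))) σ y ∈ Literature.NumberTheory.EllipticCurves.GreenbergSelmer.infKer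 κ.kerSubgroup (Literature.NumberTheory.EllipticCurves.GreenbergSelmer.Cofree ρ ↥(Literature.NumberTheory.EllipticCurves.padicCoeffField (Set.range ι))) w) ∧ (∀ (v : IsDedekindDomain.HeightOneSpectrum (NumberField.RingOfIntegers ℚ)) (hv : ((2 : ℕ) : NumberField.RingOfIntegers ℚ) ∈ v.asIdeal) (σ : Field.absoluteGaloisGroup ℚ), ∃ (φ : ↥(Literature.NumberTheory.GaloisRepresentations.contOneCocycles (Literature.NumberTheory.EllipticCurves.discreteTopRep ↥κ.kerSubgroup (Literature.NumberTheory.EllipticCurves.GreenbergSelmer.Cofree ρ ↥(Literature.NumberTheory.EllipticCurves.padicCoeffField (Set.range ι)))))) (Q : Fin n → Literature.NumberTheory.EllipticCurves.localPoints W (v.adicCompletion ℚ)) (k : ℕ), Literature.NumberTheory.GaloisRepresentations.oneCocycleClass (Literature.NumberTheory.EllipticCurves.discreteTopRep ↥κ.kerSubgroup (Literature.NumberTheory.EllipticCurves.GreenbergSelmer.Cofree ρ ↥(Literature.NumberTheory.EllipticCurves.padicCoeffField (Set.range ι)))) φ = Literature.NumberTheory.EllipticCurves.conjH1 κ.kerSubgroup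 (Literature.NumberTheory.EllipticCurves.GreenbergSelmer.Cofree ρ ↥(Literature.NumberTheory.EllipticCurves.padicCoeffField (Set.range ι))) σ y ∧ (∀ i : Fin n, (2 ^ k) • Q i ∈ ⨆ m : ℕ, Literature.NumberTheory.EllipticCurves.Kobayashi2003.signedLocalPoints κ (v.adicCompletion ℚ) W 1 m) ∧ ∀ (τ : ↥(Literature.NumberTheory.EllipticCurves.localSubgroupOfEmb κ.kerSubgroup (Literature.NumberTheory.EllipticCurves.closureEmb (K := ℚ) (v.adicCompletion ℚ)))) (i : Fin n), Literature.NumberTheory.EllipticCurves.pointsMapOfEmb W (Literature.NumberTheory.EllipticCurves.closureEmb (K := ℚ) (v.adicCompletion ℚ)) (((Θ v hv (φ.1 (Literature.NumberTheory.EllipticCurves.resGalSubgroupOfEmb κ.kerSubgroup (Literature.NumberTheory.EllipticCurves.closureEmb (K := ℚ) (v.adicCompletion ℚ)) τ))) i : ↥(W.geomPrimaryTorsion 2)) : W.geomPoints) = (τ : Field.absoluteGaloisGroup (v.adicCompletion ℚ)) • Q i - Q i) ∧ Literature.NumberTheory.EllipticCurves.GreenbergSelmer.scalarH1 κ.kerSubgroup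 (Literature.NumberTheory.EllipticCurves.GreenbergSelmer.Cofree ρ ↥(Literature.NumberTheory.EllipticCurves.padicCoeffField (Set.range ι))) ϖ y = 0}.Finite := by
    apply Set.finite_of_ncard_pos
    rw [hcount]
    exact pow_pos hposW f
  have hcm := stub_cmLambdaLower W hCM hr0 hss ha2 hΔ M g ι Ω hM hnew hcmf ha2g hΩ hcong κ γ hκ hγ hcyc S₀ hS₀ hbad hMS
    Lp Lm d hpair hle (fun k hk ↦ hlt k hk) n ρ Θ hρ hΘ ϖ hϖ
  rw [← hfinG.cast_ncard_eq, Nat.cast_le, hcount, hq, ← pow_mul, mul_comm, pow_mul] at hcm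
  exact (Nat.pow_le_pow_iff_left hf0.ne').1 hcm

end Summit.BirchSwinnertonDyer.BirchSwinnertonDyer.Cruxes.ResidualThetaCountLowerPureAtTwo.Bt26Lambda

end
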